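import Summits.QuantumFields.BalabanUV.Beta.CompositeMixedWardRooted
import Summits.QuantumFields.BalabanUV.Beta.MixedWardSiteLaw

/-!
# `BalabanUV.Beta.CompositeMixedWardRootedBricks` — row D1 ∕ (C1), PART 110c: an1's ROOTED MIXED BRICK OBEYS THE WINDOW LAW `h𝓉W`; HENCE THE SYMMETRISED COMPOSITE
# MIXED WARD LAW (HG FORM) FOR THE ROOTED COMPOSITE TABLES, HYPOTHESIS-FREE, EVERY DEPTH

HONEST DEPENDENCY (page 1, mandatory): continuum YM on T⁴ ⇐ BetaPertH ∧ nine spine estimates (0/9 proved); BetaPertH ⇐ (D1) ∧ (D4) ∧ CAP+tail;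
G-an2-4 gates asym, D1 and NE2/3/4.  HONEST FRAMING (cell contract, verbatim): «discharging `BetaPertH` makes Bałaban's UV stability UNCONDITIONAL —
a real constructive-QFT result; it is NOT the continuum limit and NOT the Clay problem.»  ABSOLUTE RULE (cell charter, verbatim): «No internally-minted
statement may enter as a cited fact. Every hypothesis is either kernel-proved in this package or a verbatim quotation of a PUBLISHED theorem with page
reference. The manuscript(s) under audit are NOT citable for their own disputed steps — they are the thing under adjudication; programme-internal
(2001/route/tribunal) claims are never citable.»

WHY (row-D1 owner an2 gen 86; FINDING AN2-86-2).  PART 110b (`CompositeMixedWardRooted.compMixKer_div_bg_symm`) proved the `f ↔ f′`-symmetrised background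
Ward law of an2's composite mixed kernel in HG form for ANY bricks under the window laws `hℓW`, `h𝓋W` (PART 105a: an1's `linKerAt_window_dz`, `vhKerAt_window_dz`),
`h𝓉W` and an antisymmetric Hessian brick.  §1 discharges `h𝓉W` for an1's ROOTED mixed brick `mixKerAt (toSite r) L` (box root, `1 ≤ L`): an2 g21's SITE law
`MixedWardSiteLaw.mixKerAt_siteWard` (`Σ_κ (t(κ,u−e_κ;f,f′) − t(κ,u;f,f′)) = 2·h(f,f′)·([u = L•y+ρ] − [u = f.2])`) summed by parts over `ℤ^{d+1}` against ANY
coarse weight `G` (support: node 12b's `tTab_eq_zero₃`), exactly as PART 106b did for the border brick.  §2 the ROOTED INSTANCE, hypothesis-free: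
`compMixKer_div_bg_symm_rooted` — an1's bricks `linKerAt ∕ vhKerAt ∕ hessKerAt ∕ mixKerAt (toSite (r k)) L`, composed root `R m = Σ_{k<m} L^k • toSite (r k)`,
antisymmetry `hessKerAt_swap`.

WHAT: [folklore] `tsum`∕finite-sum bookkeeping BY NAME; no `def`, no `def … : Prop`, nothing cited, 0 sorry.  Nothing of Bałaban's asserted, valued or discharged;
0 estimates; 0∕4 row-D1 binders; (W)_j NOT claimed; NOT (C1), NOT D1, NEVER «G-an2-4 closed», NOT BetaPertH, NOT continuum, NOT Clay.
Row D1 ∕ (C1) OWNER «beta-an2», gen 86, 2026-08-30.  No existing file touched.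
-/

noncomputable section

open Finset
open scoped BigOperators
open Literature.MathematicalPhysics.QuantumFieldTheory.Balaban1983to89
open Literature.MathematicalPhysics.QuantumFieldTheory.Balaban1983to89.Beta
open AffineAveraging (Site box toSite unitVec)
open AveragingHessianKernels (Bond Near)
open AveragingHessianKernelsRooted (linKerAt vhKerAt hessKerAt hessKerAt_swap)
open AveragingMixedJetTables (mixKerAt tTab tTab_eq_zero₃)
open Summit.QuantumFields.BalabanUV.Beta.CompositeVertexKernelRec
open Summit.QuantumFields.BalabanUV.Beta.CompositeMixedTable (compMixKer)
open Summit.QuantumFields.BalabanUV.Beta.LinearGaugeVH (nearBox mem_nearBox)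
open Summit.QuantumFields.BalabanUV.Beta.MixedWardSiteLaw (mixKerAt_siteWard)
open Summit.QuantumFields.BalabanUV.Beta.CompositeVertexWardRooted
open Summit.QuantumFields.BalabanUV.Beta.CompositeMixedWardRooted (compMixKer_div_bg_symm)

namespace Summit.QuantumFields.BalabanUV.Beta.CompositeMixedWardRootedBricks

variable {d : ℕ}

/-! ## §1 an1's rooted mixed brick obeys the window law `h𝓉W` -/

section Rooted

variable {L : ℕ} {r : Fin (d + 1) → ℕ}

/-- [folklore] support of the rooted mixed brick in its background slot (node 12b `tTab_eq_zero₃`). -/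
theorem mixKerAt_eq_zero_bg (hr : r ∈ box (d + 1) L) (μ : Fin (d + 1)) (y : Site (d + 1)) (f f' : Bond (d + 1)) {κ : Fin (d + 1)}
    {x : Site (d + 1)} (hx : ¬ Near L y x) : mixKerAt (toSite r) L μ y (κ, x) f f' = 0 := by
  show ((tTab (toSite r) L μ y f f' (κ, x) : ℚ) : ℝ) = 0
  rw [tTab_eq_zero₃ hr μ y f f' (g := (κ, x)) hx, Rat.cast_zero]

/-- [folklore] an2 g21's site law (`MixedWardSiteLaw.mixKerAt_siteWard`), `1 ≤ L` form: the background divergence of the rooted mixed brick at the site `u` is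
`2·hessKerAt f f′ · ([u = L•y + ρ] − [u = f.2])`. -/
theorem mixKerAt_div_bg (hL : 1 ≤ L) (ρ : Site (d + 1)) (μ : Fin (d + 1)) (y u : Site (d + 1)) (f f' : Bond (d + 1)) :
    ∑ κ : Fin (d + 1), (mixKerAt ρ L μ y (κ, u - unitVec κ) f f' - mixKerAt ρ L μ y (κ, u) f f') =
      2 * hessKerAt ρ L μ y f f' * ((if u = (L : ℤ) • y + ρ then (1 : ℝ) else 0) - (if u = f.2 then (1 : ℝ) else 0)) :=
  mixKerAt_siteWard (show L ≠ 0 by omega) ρ μ y u f f'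

/-- [folklore] **THE WINDOW BACKGROUND LAW OF THE ROOTED MIXED BRICK** (`h𝓉W` for `mixKerAt (toSite r) L`, box root, `1 ≤ L`), for ANY coarse weight `G`:
`Σ_κ Σ_{e ∈ offs} mixKerAt (κ, L•y+e) f f′ · (G (L•y+e+e_κ) − G (L•y+e)) = 2 · hessKerAt f f′ · (G (L•y+ρ) − G f.2)` — `mixKerAt_div_bg` summed by parts over `ℤ^{d+1}`. -/
theorem mixKerAt_window_dz (hL : 1 ≤ L) (hr : r ∈ box (d + 1) L) (μ : Fin (d + 1)) (y : Site (d + 1)) (f f' : Bond (d + 1)) (G : Site (d + 1) → ℝ) :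
    ∑ κ : Fin (d + 1), ∑ e ∈ offs L, mixKerAt (toSite r) L μ y (κ, (L : ℤ) • y + e) f f' * (G ((L : ℤ) • y + e + unitVec κ) - G ((L : ℤ) • y + e)) =
      2 * hessKerAt (toSite r) L μ y f f' * (G ((L : ℤ) • y + toSite r) - G f.2) := by
  classical
  have hsupp : ∀ (κ : Fin (d + 1)) (x : Site (d + 1)), x ∉ nearBox L y → mixKerAt (toSite r) L μ y (κ, x) f f' = 0 :=
    fun κ x hx => mixKerAt_eq_zero_bg hr μ y f f' (fun h => hx (mem_nearBox.2 h))
  have hsupp' : ∀ (κ : Fin (d + 1)) (x : Site (d + 1)), x ∉ (nearBox L y).image (fun x' => x' + unitVec κ) →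
      mixKerAt (toSite r) L μ y (κ, x - unitVec κ) f f' = 0 := by
    intro κ x hx
    apply hsupp κ (x - unitVec κ)
    intro hmem
    exact hx (Finset.mem_image.2 ⟨x - unitVec κ, hmem, sub_add_cancel x (unitVec κ)⟩)
  have hs1 : ∀ κ : Fin (d + 1), Summable fun x : Site (d + 1) => mixKerAt (toSite r) L μ y (κ, x - unitVec κ) f f' * G x :=
    fun κ => summable_of_ne_finset_zero (s := (nearBox L y).image (fun x' => x' + unitVec κ)) fun x hx => by rw [hsupp' κ x hx, zero_mul]
  have hs2 : ∀ κ : Fin (d + 1), Summable fun x : Site (d + 1) => mixKerAt (toSite r) L μ y (κ, x) f f' * G x :=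
    fun κ => summable_of_ne_finset_zero (s := nearBox L y) fun x hx => by rw [hsupp κ x hx, zero_mul]
  have hs3 : ∀ κ : Fin (d + 1), Summable fun x : Site (d + 1) =>
      (mixKerAt (toSite r) L μ y (κ, x - unitVec κ) f f' - mixKerAt (toSite r) L μ y (κ, x) f f') * G x :=
    fun κ => ((hs1 κ).sub (hs2 κ)).congr fun x => by ring
  have key : ∀ κ : Fin (d + 1), ∑ e ∈ offs L, mixKerAt (toSite r) L μ y (κ, (L : ℤ) • y + e) f f' * (G ((L : ℤ) • y + e + unitVec κ) - G ((L : ℤ) • y + e)) =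
      ∑' x : Site (d + 1), (mixKerAt (toSite r) L μ y (κ, x - unitVec κ) f f' - mixKerAt (toSite r) L μ y (κ, x) f f') * G x := by
    intro κ
    have hA : ∑' x : Site (d + 1), mixKerAt (toSite r) L μ y (κ, x - unitVec κ) f f' * G x =
        ∑ e ∈ offs L, mixKerAt (toSite r) L μ y (κ, (L : ℤ) • y + e) f f' * G ((L : ℤ) • y + e + unitVec κ) := by
      rw [← (Equiv.addRight (unitVec κ)).tsum_eq (fun x : Site (d + 1) => mixKerAt (toSite r) L μ y (κ, x - unitVec κ) f f' * G x)]
      simp only [Equiv.coe_addRight, add_sub_cancel_right]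
      rw [tsum_eq_sum (s := nearBox L y) (fun x hx => by rw [hsupp κ x hx, zero_mul])]
      exact (sum_offs_eq_sum_nearBox y (fun x => mixKerAt (toSite r) L μ y (κ, x) f f' * G (x + unitVec κ))).symm
    have hB : ∑' x : Site (d + 1), mixKerAt (toSite r) L μ y (κ, x) f f' * G x =
        ∑ e ∈ offs L, mixKerAt (toSite r) L μ y (κ, (L : ℤ) • y + e) f f' * G ((L : ℤ) • y + e) := by
      rw [tsum_eq_sum (s := nearBox L y) (fun x hx => by rw [hsupp κ x hx, zero_mul])]
      exact (sum_offs_eq_sum_nearBox y (fun x => mixKerAt (toSite r) L μ y (κ, x) f f' * G x)).symm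
    calc ∑ e ∈ offs L, mixKerAt (toSite r) L μ y (κ, (L : ℤ) • y + e) f f' * (G ((L : ℤ) • y + e + unitVec κ) - G ((L : ℤ) • y + e))
        = ∑ e ∈ offs L, mixKerAt (toSite r) L μ y (κ, (L : ℤ) • y + e) f f' * G ((L : ℤ) • y + e + unitVec κ) -
            ∑ e ∈ offs L, mixKerAt (toSite r) L μ y (κ, (L : ℤ) • y + e) f f' * G ((L : ℤ) • y + e) := by
          simp only [mul_sub, Finset.sum_sub_distrib]
      _ = ∑' x : Site (d + 1), mixKerAt (toSite r) L μ y (κ, x - unitVec κ) f f' * G x -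
            ∑' x : Site (d + 1), mixKerAt (toSite r) L μ y (κ, x) f f' * G x := by rw [hA, hB]
      _ = ∑' x : Site (d + 1), (mixKerAt (toSite r) L μ y (κ, x - unitVec κ) f f' * G x - mixKerAt (toSite r) L μ y (κ, x) f f' * G x) :=
          ((hs1 κ).tsum_sub (hs2 κ)).symm
      _ = _ := tsum_congr fun x => by ring
  have hsP : Summable fun x : Site (d + 1) => (if x = (L : ℤ) • y + toSite r then (1 : ℝ) else 0) * (2 * hessKerAt (toSite r) L μ y f f' * G x) :=
    summable_of_ne_finset_zero (s := {(L : ℤ) • y + toSite r}) fun x hx => by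
      rw [Finset.mem_singleton] at hx; rw [if_neg hx, zero_mul]
  have hsQ : Summable fun x : Site (d + 1) => (if x = f.2 then (1 : ℝ) else 0) * (2 * hessKerAt (toSite r) L μ y f f' * G x) :=
    summable_of_ne_finset_zero (s := {f.2}) fun x hx => by
      rw [Finset.mem_singleton] at hx; rw [if_neg hx, zero_mul]
  calc ∑ κ : Fin (d + 1), ∑ e ∈ offs L, mixKerAt (toSite r) L μ y (κ, (L : ℤ) • y + e) f f' * (G ((L : ℤ) • y + e + unitVec κ) - G ((L : ℤ) • y + e))
      = ∑ κ : Fin (d + 1), ∑' x : Site (d + 1), (mixKerAt (toSite r) L μ y (κ, x - unitVec κ) f f' - mixKerAt (toSite r) L μ y (κ, x) f f') * G x :=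
        Finset.sum_congr rfl fun κ _ => key κ
    _ = ∑' x : Site (d + 1), ∑ κ : Fin (d + 1), (mixKerAt (toSite r) L μ y (κ, x - unitVec κ) f f' - mixKerAt (toSite r) L μ y (κ, x) f f') * G x :=
        (Summable.tsum_finsetSum fun κ _ => hs3 κ).symm
    _ = ∑' x : Site (d + 1), 2 * hessKerAt (toSite r) L μ y f f' *
          ((if x = (L : ℤ) • y + toSite r then (1 : ℝ) else 0) - (if x = f.2 then (1 : ℝ) else 0)) * G x := by
        refine tsum_congr fun x => ?_
        rw [← Finset.sum_mul, mixKerAt_div_bg hL (toSite r) μ y x f f']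
    _ = (∑' x : Site (d + 1), (if x = (L : ℤ) • y + toSite r then (1 : ℝ) else 0) * (2 * hessKerAt (toSite r) L μ y f f' * G x)) -
          ∑' x : Site (d + 1), (if x = f.2 then (1 : ℝ) else 0) * (2 * hessKerAt (toSite r) L μ y f f' * G x) := by
        rw [← hsP.tsum_sub hsQ]
        exact tsum_congr fun x => by ring
    _ = 2 * hessKerAt (toSite r) L μ y f f' * (G ((L : ℤ) • y + toSite r) - G f.2) := by
        rw [tsum_eq_single ((L : ℤ) • y + toSite r) (fun x hx => by rw [if_neg hx, zero_mul]),
          tsum_eq_single f.2 (fun x hx => by rw [if_neg hx, zero_mul]), if_pos rfl, if_pos rfl]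
        ring

/-! ## §2 The rooted instance of the symmetrised composite mixed Ward law (HG form), hypothesis-free -/

/-- [folklore] **THE SYMMETRISED COMPOSITE MIXED WARD LAW FOR an1's ROOTED BRICKS, HG FORM, EVERY DEPTH** (bricks `linKerAt ∕ vhKerAt ∕ hessKerAt ∕ mixKerAt (toSite (r k)) L`,
in-block roots, `1 ≤ L`; composed root `R m = Σ_{k<m} L^k • toSite (r k)`):
`Σ_κ [(compMixKer m μ y (κ, z − e_κ) f f′ − compMixKer m μ y (κ, z) f f′) + (f ↔ f′)] = 2 · compVHKer ℓ 𝒽ᴳ L m μ y f f′` with the Hessian brick weighted by the gauge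
jump between its own-level rooted legs, `𝒽ᴳ k ν w b₁ b₂ = hessKerAt (toSite (r k)) L ν w b₁ b₂ · ([L^k•b₂.2 + R k = z] − [L^k•b₁.2 + R k = z])`. -/
theorem compMixKer_div_bg_symm_rooted (hL : 1 ≤ L) {r : ℕ → Fin (d + 1) → ℕ} (hr : ∀ k, r k ∈ box (d + 1) L) (z : Site (d + 1)) (m : ℕ)
    (μ : Fin (d + 1)) (y : Site (d + 1)) (f f' : Bond (d + 1)) :
    ∑ κ₀ : Fin (d + 1),
        ((compMixKer (fun k => linKerAt (toSite (r k)) L) (fun k => vhKerAt (toSite (r k)) L) (fun k => hessKerAt (toSite (r k)) L)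
              (fun k => mixKerAt (toSite (r k)) L) L m μ y (κ₀, z - unitVec κ₀) f f' -
            compMixKer (fun k => linKerAt (toSite (r k)) L) (fun k => vhKerAt (toSite (r k)) L) (fun k => hessKerAt (toSite (r k)) L)
              (fun k => mixKerAt (toSite (r k)) L) L m μ y (κ₀, z) f f') +
          (compMixKer (fun k => linKerAt (toSite (r k)) L) (fun k => vhKerAt (toSite (r k)) L) (fun k => hessKerAt (toSite (r k)) L)
              (fun k => mixKerAt (toSite (r k)) L) L m μ y (κ₀, z - unitVec κ₀) f' f -
            compMixKer (fun k => linKerAt (toSite (r k)) L) (fun k => vhKerAt (toSite (r k)) L) (fun k => hessKerAt (toSite (r k)) L)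
              (fun k => mixKerAt (toSite (r k)) L) L m μ y (κ₀, z) f' f)) =
      2 * compVHKer (fun k => linKerAt (toSite (r k)) L)
        (fun k ν w b₁ b₂ => hessKerAt (toSite (r k)) L ν w b₁ b₂ *
          ((if ((L ^ k : ℕ) : ℤ) • b₂.2 + ∑ i ∈ Finset.range k, ((L ^ i : ℕ) : ℤ) • toSite (r i) = z then (1 : ℝ) else 0) -
            (if ((L ^ k : ℕ) : ℤ) • b₁.2 + ∑ i ∈ Finset.range k, ((L ^ i : ℕ) : ℤ) • toSite (r i) = z then (1 : ℝ) else 0))) L m μ y f f' :=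
  compMixKer_div_bg_symm (ρ := fun k => toSite (r k)) (R := fun m => ∑ i ∈ Finset.range m, ((L ^ i : ℕ) : ℤ) • toSite (r i))
    (by simp) (fun m => by rw [Finset.sum_range_succ]) (fun k μ y G => linKerAt_window_dz hL (hr k) μ y G)
    (fun k μ y f G => vhKerAt_window_dz hL (hr k) μ y f G) (fun k μ y f f' G => mixKerAt_window_dz hL (hr k) μ y f f' G)
    (fun k μ y f f' => hessKerAt_swap (toSite (r k)) L μ y f f') z m μ y f f'

end Rooted

end Summit.QuantumFields.BalabanUV.Beta.CompositeMixedWardRootedBricks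

end
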